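import Summits.QuantumFields.YangMills.Theorems.HyperbolicRegulatorCurvatureAnchorRReduction

/-!
## STATUS (lead `prover-line-stmt-QuantumFields-18155-0`, after wave 1, 2026-08-17T19:30Z) — skeleton v3

LANDED: `stub_ct` (`Theorems/…StubCt`, p173035), `stub_kunneth` (`…StubKunneth` p174031 + `…StubKunnethFactor` p173755 +
`…StubKunnethHodge` p173877), `stub_instantiate` (`…StubInstantiate` p173947 + `…StubInstantiateHelpers` p173616), the
Defs (`…Defs` p172347; `…DefsB`: `TowersHyp`/`MixingHyp` = verbatim statements of the two remaining stubs) and the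
sorry-free REDUCTION `CurvatureAnchorR_of_hyps : TowersHyp → MixingHyp → CurvatureAnchorR` (`…Reduction`).
OPEN (2 sorries, both crux-sized): `stub_towers : TowersHyp` (expander square towers — assessment
`Lines/witten_hessian-stub_towers-assessment.md`: PROMOTE to items ExpanderSquareTowers + SubdivisionAdmissible; the
load-bearing unformalised input is the congruence spectral gap of the arithmetic (2,4,5) surface) and `stub_mixing :
MixingHyp` (the open analytic core).  The composition below is now one line.  The original strategist docstring follows.


# Line `witten_hessian` for crux `CurvatureAnchorR` (stmt-QuantumFields-18155) — `Lines/witten_hessian.lean`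

Strategist line (crux-strategist seat `planner-cstrat-stmt-QuantumFields-18155-b1-0`, 2026-08-17), an ALTERNATIVE to
`Lines/giant_beta_gjs.lean` for the same crux `Summit.QuantumFields.YangMills.Theses.HyperbolicRegulator.CurvatureAnchorR`
(route `route-QuantumFields-HyperbolicRegulator`, rank 3, CONSTRUCTION + ANCHOR).  It realises, as a checked skeleton for
the REPAIRED crux, the two Helffer–Sjöstrand crux ideas filed on the predecessor crux 15826 and never triaged there
(`Cruxes/CurvatureAnchor/Ideas/witten-hessian-rate.md`, ideator 2; `…/witten-cbs-angle.md`, ideator 1), sharpened by the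
strategist's finding (§2) of WHY an L²-only method is the natural one on a non-amenable complex.

## §1 The lever: the anchor rate is the Hessian's, read through the Helffer–Sjöstrand 1-form resolvent

`β₀(k)` is free in the crux, so at fixed `k` the anchor is a DEEP SEMICLASSICAL statement (`h = 1/β → 0`) on the compact
configuration manifold `M = G^{PE}` of `X_j = S_(k,j) × S_(k,j)` with phase `Φ = −β S_Wilson`.  Helffer–Sjöstrand:
`Cov_μ(f, g) = ∫ ⟨df, (Δ_Φ^{(1)})⁻¹ dg⟩ dμ`, `Δ_Φ^{(1)} = −L ⊗ 1 + Hess Φ + Ric` the Witten Laplacian on 1-forms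
(`L` the `μ`-symmetric Langevin generator).  In the link index `ℓ ∈ PE`, `−L ⊗ 1` and `Ric` (compact simple `G` is
Einstein) are DIAGONAL; the only term moving the index is `Hess Φ = −β Hess S`, of range one plaquette and absolute row sums
`≤ C β`.  The transversal Hessian of `S` at the flat connection is the Künneth-gapped 1-form Hodge Laplacian `Δ₁` of the
product complex (`KunnethGap`: gap `10⁻⁷/k²` off the torons — `stub_kunneth`, true), so the expected form bound is
`Δ_Φ^{(1)} ≥ c₀ β · 10⁻⁷/k²` on `G^V`-invariant exact 1-forms off the Morse–Bott toron sector.  GIVEN such a bound, the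
Combes–Thomas conjugation with the symmetric/antisymmetric split (`CombesThomasSqrt`, `stub_ct`: the symmetric part of
`e^{μρ} H e^{−μρ} − H` has norm `≤ (cosh μ − 1)·τ`, the antisymmetric part drops out of the quadratic form) gives
`|Cov(f, g)| ≤ (2k²/(c₀β 10⁻⁷)) e^{−μ·d(supp f, supp g)} ‖df‖ ‖dg‖` with `(cosh μ − 1)·Cβ ≤ c₀β 10⁻⁷/(2k²)`, i.e.
`μ = c/k` with `c` INDEPENDENT of `k`, `β` and `j` — the anchor's rate, read off ONE operator inequality, with no
expansion, no renormalisation group, and no summability of anything.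

## §2 Why L²-only is not a convenience but the point (strategist, new): ℓ¹-marginality of the expansion-gapped Gaussian

The sibling line `giant_beta_gjs` ports a Glimm–Jaffe–Spencer / Kotecký–Preiss expansion (Chatterjee–Yakir 2025) whose
convergence criterion is an ℓ¹-type norm of the reference covariance.  On the hyperbolic factor the heat kernel at time
`t ≫ k²` lives on a ring of radius `≍ t/k` on which it varies at unit relative rate radially, so `‖∇p_t‖_{ℓ¹} ≍ 1/k` for
ALL `t` up to the mixing time `≍ k² log vol_j`; hence `sup_x Σ_y |∇G^⊥(x, y)| ≍ k · log vol_j` although `|∇G^⊥(x,y)|`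
decays pointwise at rate `≍ 1/k` — decay rate EQUALS volume entropy (Brooks `λ₀ ≤ h²/4`; for the scalar Green's function
`Σ_y G = Σ_n 1 = ∞` on any graph: a mass that comes from expansion is always ℓ¹-marginal).  A single-scale expansion at
fixed `β` therefore converges only while `k log vol_j ≲ β^{1/2}/poly(k)`, not for all `j ≥ j₀`.  The Helffer–Sjöstrand +
Combes–Thomas route consumes exactly and only the L² form bound — the one thing non-amenability supplies uniformly in `j`.
(The marginal ℓ^∞-bottom of `Δ₁` on the simply connected cover consists of CLOSED 1-forms, i.e. it is pure gauge; the
HS identity never sees it because `dg` of a gauge-invariant `g` annihilates gauge directions.)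

## §3 The cut (5 stubs)

* `stub_towers` — COMBINATORICS (G-free, L): VERBATIM the statement of `Lines/giant_beta_gjs.lean` (admissible `AdmR`,
  tame at a diameter-dominating scale `L ≥ j` — log-girth congruence towers of the `(2,4,5)` triangle group —, `Coh`,
  `DualPoinc`).  One proof serves both lines (the defs are textually identical).
* `stub_kunneth` — SPECTRAL GRAPH THEORY (G-free, TRUE, M/L): VERBATIM the sibling's (`SqCx ∧ Poinc ∧ Coh ∧ DualPoinc ⇒
  KunnethGap`).
* `stub_ct` — `CombesThomasSqrt` (G-free, TRUE, M): the engine as a finite-matrix lemma (§1); provable now from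
  `Matrix.PosSemidef` and three lines of algebra; the form-level run on `Δ_Φ^{(1)}` inside `stub_mixing` is the same
  computation (or apply it to finite-dimensional Galerkin truncations in `L²(μ) ⊗ ℝ^{PE}`).
* `stub_mixing` — THE ANALYSIS (XL, open, load-bearing): for every family as delivered by `stub_towers` and
  Künneth-gapped, and given `CombesThomasSqrt`: ONE `c > 0`, per `k ≥ 8` a `β₀(k)`, per `β ≥ β₀(k)` ONE `K` such that for
  ALL `j ≥ k` every pair of bounded measurable cylinder functions with CONTRACTIBLE supports (radius `⌊k/2⌋` around product
  vertices) at centre distance `> 2k` has covariance `≤ K ‖f‖∞‖g‖∞ e^{−(c/k)(dist + dist′)}` under the crux's Wilson–Gibbs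
  ratio (byte-identical `S`, `ν`, `X`).  No charts, no species, no flat points.
* `stub_instantiate` — MEASURE-THEORETIC INTERFACE (M): mixing for `j ≥ k` ⇒ the crux's clustering predicate for chart-read
  `YMSpecies` of support `≤ ⌊k/8⌋` at C′-flat points (`AdmR` chart walk: links read lie within `⌊k/2⌋` of the base points;
  near pairs by boundedness; `j₀ := k`).
* `CurvatureAnchorR_of` — the composition BY NAME (type literally the route decl).

## §4 Torons, essential loops, and why the typing restricts supports

The critical manifold of `Φ` is Morse–Bott: gauge orbit × toron variety (flat connections; `b₁(S_j) = 2g_j ≍ vol`, forced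
by Gauss–Bonnet on every admissible closed square surface).  A gauge-invariant observable with CONTRACTIBLE support is
constant along exactly-flat directions (a flat connection on a simply connected ball is pure gauge), so `df|_{T𝓜} = 0` and
the toron sector enters `Cov` only through `Cov_t(E[f|t], E[g|t])`, each factor `≲ e^{−(c/k)·injrad_j}` (charged
fluctuations feel the holonomy `t` only around essential loops): a distance-INDEPENDENT term `≲ e^{−(2c/k) injrad_j}`,
which is `≤ K e^{−(c′/k)·2 diam_j}` exactly when `diam_j ≤ C_T · injrad_j` — the log-girth clause of `stub_towers` is
consumed here, as in the sibling line.  By contrast a Wilson loop around an ESSENTIAL cycle `γ × {y}` reads `t` directly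
and IS long-range correlated with `γ × {y′}` across the transverse factor (the hyperbolic femto-universe's Polyakov-loop
analogue): `stub_mixing` is therefore typed for supports of radius `⌊k/2⌋ < L ≤ injrad` only, and for centre distance
`> 2k` (product-vertex-disjoint supports, so that non-invariant `f, g` reduce to their gauge averages:
`Cov(f,g) = Cov(f^{av}, g^{av})` because the gauge group is a product over vertices).  Neither excluded class contains a
crux observable (support radius `⌊k/8⌋` at flat points, pairs at distance `≥ j → ∞`).

## §5 Disproof used

No `Disproof.lean` exists yet for stmt-QuantumFields-18155.  From the predecessor's `Cruxes/CurvatureAnchor/Disproof.lean`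
(refuter-cdisprove-15826): §2 `AdmR` (copied byte-exactly), `repair_arith`, `AdmR.chart_dist_le` (the walk estimate
`stub_instantiate` needs), `AdmR.chart_avoids_cones`; §3(b) the anchor functional is a genuine Haar–Gibbs ratio with bounded
observables (what `stub_instantiate` formalises); §3(f) `stub_kunneth` true; §4 the toron floor at fixed `(k, β)` — §4 above
is this line's typed answer (contractible supports + `diam ≤ C_T·L`).  No `_false_without_` theorem exists; `ledger
negatives --problem QuantumFields` has no entry on square complexes / expanders / Witten Laplacians; the dropped pre-repair
`Adm` appears nowhere in this file.

## §6 BC3-type probes (`bc/probe_witten.lean`, this seat; rc 1, wall 220 s)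

`CombesThomasSqrt → CurvatureAnchorR` by `exact? | aesop`: fails ("made no progress"); `stub_mixing`-statement
`→ CurvatureAnchorR`, `→ YangMills`, and the statement itself by `exact? | aesop`: all fail (heartbeat timeouts at
`isDefEq`/`whnf`, simp step limit); `stub_instantiate`-statement `→ CurvatureAnchorR` and itself: both fail (timeouts).
(`example : CombesThomasSqrt := by exact?` inside the same file finds only the sorried `stub_ct` itself — a self-hit, not
a library duplicate; Mathlib has no Combes–Thomas estimate.)

`lean check`: rc 0; sorries = 5 = stubs (`stub_towers`, `stub_kunneth`, `stub_ct`, `stub_mixing`, `stub_instantiate`),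
zero elsewhere; audit: `CurvatureAnchorR_of` proves the route item BY NAME.
Namespace `Summit.QuantumFields.YangMills.Cruxes.CurvatureAnchorR.WittenHessian`.
-/

set_option autoImplicit false

noncomputable section

namespace Summit.QuantumFields.YangMills.Cruxes.CurvatureAnchorR.WittenHessian

open scoped BigOperators Topology Manifold Classical MeasureTheory ProbabilityTheory Matrix InnerProductSpace ComplexConjugate ContinuousMap
open Filter Set Function TopologicalSpace MeasureTheory
open Literature.MathematicalPhysics.QuantumFieldTheory Literature.MathematicalPhysics.QuantumLattice
open Summit.QuantumFields.YangMills.Theses.HyperbolicRegulator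

/-- **Stub T — LOG-GIRTH EXPANDER SQUARE TOWERS** (`TowersHyp` of `…DefsB`, verbatim the strategist's statement;
crux-sized per the line's assessment file — to be promoted; intended witness: `k`-subdivided congruence covers of the
`{4,5}` tiling of the arithmetic `(2,4,5)` surface). -/
theorem stub_towers : TowersHyp := by
  sorry

/-- **Stub M — CONTRACTIBLE-SUPPORT EXPONENTIAL MIXING AT GIANT `β`, `j`-UNIFORM** (`MixingHyp` of `…DefsB`, verbatim
the strategist's statement; the open analytic core of the crux: a form bound for the Witten Laplacian of the Wilson
action on `G^V`-invariant exact 1-forms off the toron sector, read through Helffer–Sjöstrand + `CombesThomasSqrt`). -/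
theorem stub_mixing : MixingHyp := by
  sorry

/-- **Composition (registered form, v3)** — the two remaining stubs BY NAME give the crux BY NAME through the landed
reduction `CurvatureAnchorR_of_hyps` (which consumes the landed `stub_ct`, `stub_kunneth`, `stub_instantiate`). -/
theorem CurvatureAnchorR_of :
    Summit.QuantumFields.YangMills.Theses.HyperbolicRegulator.CurvatureAnchorR :=
  CurvatureAnchorR_of_hyps stub_towers stub_mixing

/-- Signature match: the registered composition has literally the route's crux as its type. -/
example : Summit.QuantumFields.YangMills.Theses.HyperbolicRegulator.CurvatureAnchorR := CurvatureAnchorR_of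

end Summit.QuantumFields.YangMills.Cruxes.CurvatureAnchorR.WittenHessian

end
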